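import Summits.CriticalPhenomena.SAWScalingLimit.Theses.SAWQuarterTwist
import Summits.CriticalPhenomena.SAWScalingLimit.Cruxes.HexObservableLimitR.Lines.explicit_bump_synthesis

/-!
# Line `shared_green` — ALTERNATIVE skeleton for the crux `BulkToBoundary` (stmt-CriticalPhenomena-16652)
(crux-strategist b1, 2026-08-17; the registered line `Lines/birth.lean` is untouched)

Crux (FIXED; rank 4 of `route-CriticalPhenomena-SAWQuarterTwist`):

  `BulkToBoundary : TwistedPropagatorLaw → BulkScalingLimitExists → HexObservableLimitR`.

## The finding this line encodes

The strategy census of this seat (`Cruxes/BulkToBoundary/STRATEGY-CENSUS.md`) shows that the two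
antecedents — (P) the whole-plane quarter-twisted propagator law and (B) the existence of
bulk-sourced scaling limits on compacts of `Ω ∖ {p}` — give NO LEVERAGE on the conclusion
`HexObservableLimitR` (the repaired DCS Conjecture 2, shared target stmt-CriticalPhenomena-14003):
every exact lattice bridge between the bulk-sourced twisted family and the boundary-sourced DCS
observable (boundary fission at the root vertex; walk reversal) lands at lattice distance `O(δ)` from
`∂Ω` or loses the vertex relation, while (B) controls sources at macroscopic distance only and says
nothing class-resolved or boundary-inclusive. So the open content of `BulkToBoundary` IS the open
content of the target, and the honest cut is the target's own Green-form cut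
(`Cruxes/HexObservableLimitR/Lines/Ideator1Sketch.lean`, `…/explicit_bump_synthesis.lean`):

* `stub_massBound`    (SAW, open) — `F_δ(b_δ)`-normalised `L¹` mass bound on compacts of `ℂ ∖ {a}`;
* `stub_twistNull`    (SAW, open) — the class-twisted pairing with `∂χ` tends to `0` (weak curl-freeness);
* `stub_boundaryFlux` (SAW, open) — the normalised boundary flux paired with `χ` converges to
  `c' ∫_Ω ∂̄χ · e^{(5/8)(L − L_b)}` with ONE universal `c' ≠ 0`.

The three stubs are repeated here VERBATIM — name AND signature — from the two registered lines of
crux 14003, so that ONE proof of any of them serves both cruxes (`supports.stub-mismatch`-safe), and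
the identification layer is not re-done: it is IMPORTED, fully proved, from
`explicit_bump_synthesis.lean` (`bumpSynthesis_of_stubs`, standard axioms) together with the three
LANDED helpers `stub_reindex` (p87892), `stub_greenLimit` (p90531), `stub_densityIntegrable` (p91481).

`BulkToBoundary_of` (kernel-checked, no `sorry` of its own) is `hexObservableLimitR_of` (the
hypothesis-form of the target line's composition, re-proved here for the SAWQuarterTwist copy of the
target, which is the byte-identical proposition — `hexObservableLimitR_iff_defectDecoherence : _ ↔ _`
is `Iff.rfl`) followed by weakening in (P), (B). That (P), (B) are not consumed is the POINT, recorded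
as `BulkToBoundary_of_target : HexObservableLimitR → BulkToBoundary`; compare the route refuter's
note on the item ("vacuously true if P or B fails, else equivalent to 14003").

Why it dodges the stuck goal of `birth`: `birth`'s hardest stub `stub_sourceToBoundary :
P → B → BoundaryPrecompact` asks for precompactness WITH HOLOMORPHIC subsequential limits of the
boundary family — i.e. `stub_massBound ∧ stub_twistNull` plus a Montel/Weyl extraction (subsequential
weak-* limits of complex measures + Weyl's lemma, neither in Mathlib) — from hypotheses that cannot
feed it; and `birth`'s `stub_rhUniqueness : P → BoundaryIdentification` hides the whole boundary
behaviour (`stub_boundaryFlux`) inside a continuum-looking uniqueness statement. Here the SAW content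
is split along the Green identity (interior pairing `I(∂̄χ) + J(∂χ)` = boundary flux, landed as
`stub_greenLimit`), the extraction is SUBSEQUENCE-FREE and PROVED, and no phantom hypothesis appears.

Disproof / negatives used: there is no `Cruxes/BulkToBoundary/Disproof.lean` (2026-08-17); the
target's `Cruxes/HexObservableLimitR/Disproof.lean` F1–F7 apply verbatim (F5: every hypothesis of the
flat-pinned frame is load-bearing — the three stubs carry the frame's hypotheses unchanged; F2: the
universal constant is real; F6: the frame is satisfiable, no vacuous closing).
`ledger negatives --problem CriticalPhenomena`: stmt-5420 (unpinned `HexObservableLimit`, corridor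
witness) is excluded by the pinning hypotheses carried by all three stubs.
-/

noncomputable section

namespace Summit.CriticalPhenomena.SAWScalingLimit.Cruxes.BulkToBoundary.SharedGreen

open Literature.Probability.RandomPlanarGeometry Literature.Probability.RandomPlanarGeometry.SAW
open Literature.Probability.LatticeModels Literature.Barriers.CriticalPhenomena
open Literature.Barriers.CriticalPhenomena.HexGreen
open Summit.CriticalPhenomena.SAWScalingLimit.Theorems.ConjugateClassNegligibleSynthesis
open Summit.CriticalPhenomena.SAWScalingLimit.Theorems.HexObservableLimitR
  (stub_reindex stub_greenLimit stub_densityIntegrable)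
open Summit.CriticalPhenomena.SAWScalingLimit.Cruxes.HexObservableLimitR.ExplicitBump
  (bumpSynthesis_of_stubs pt_not_mem_carrier)
open scoped BigOperators Topology ComplexConjugate
open Filter MeasureTheory Set Metric

/-! ## §1 The registered stubs (the ONLY `sorry`s of this file) — VERBATIM from crux 14003's lines -/

/-! ### Stub 1 — the normalised mass bound (SAW input, open) -/

/-- **Mass bound (MB⁺).** In the setting of the crux, for every compact `K ⊆ ℂ` not containing the
root `a = D.pt 0` (it may meet `∂Ω` elsewhere), the `F_δ(b_δ)`-normalised `L¹`-mass of the critical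
observable on the interior mid-edges with rescaled midpoint in `K` is eventually bounded:
`δ² Σ_{e ⊂ Λ_δ, δe ∈ K} |F_δ(e)| / |F_δ(b_δ)| ≤ C_K`. -/
theorem stub_massBound (D : DobrushinDomain) (ρ : ℝ) (Λ : ℝ → Finset HexVertex)
    (m : Fin 2 → ℝ → ℤ) (a b : ℝ → Sym2 HexVertex)
    (Φ : ConformalEquiv D.carrier UpperHalfPlane.upperHalfPlaneSet) (L : ℂ → ℂ) (Lb : ℂ)
    (hρ : 0 < ρ)
    (hflat : ∀ i : Fin 2, D.carrier ∩ ball (D.pt i) ρ = {z : ℂ | (D.pt i).im < z.im} ∩ ball (D.pt i) ρ)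
    (hdisc : ∀ᶠ δ : ℝ in 𝓝[>] 0, hexDomainSimplyConnected (Λ δ) ∧ a δ ∈ hexDomainBoundary (Λ δ) ∧
      b δ ∈ hexDomainBoundary (Λ δ) ∧ Nonempty (HexMidEdgeSAW (Λ δ) (a δ) (b δ)) ∧
      (hexGraph.induce ((Λ δ : Finset HexVertex) : Set HexVertex)).Preconnected ∧
      (∀ v ∈ Λ δ, (δ : ℂ) * hexCenter v ∈ D.carrier) ∧
      (∀ i : Fin 2, ∀ v : HexVertex, (δ : ℂ) * hexCenter v ∈ ball (D.pt i) ρ → (v ∈ Λ δ ↔ m i δ ≤ v.1 1)))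
    (hexh : ∀ K : Set ℂ, IsCompact K → K ⊆ D.carrier → ∀ᶠ δ : ℝ in 𝓝[>] 0,
      ∀ v : HexVertex, (δ : ℂ) * hexCenter v ∈ K → v ∈ Λ δ)
    (ha : Tendsto (fun δ : ℝ => (δ : ℂ) * hexMidpoint (a δ)) (𝓝[>] 0) (𝓝 (D.pt 0)))
    (hb : Tendsto (fun δ : ℝ => (δ : ℂ) * hexMidpoint (b δ)) (𝓝[>] 0) (𝓝 (D.pt 1)))
    (hΦa : Tendsto (fun x => ‖Φ x‖) (𝓝[D.carrier] (D.pt 0)) atTop)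
    (hΦb : Φ.HasBoundaryValue (D.pt 1) 0)
    (hL : ContinuousOn L D.carrier) (hexpL : ∀ z ∈ D.carrier, Complex.exp (L z) = deriv Φ z)
    (hLb : Tendsto L (𝓝[D.carrier] (D.pt 1)) (𝓝 Lb)) :
    ∀ K : Set ℂ, IsCompact K → D.pt 0 ∉ K → ∃ C : ℝ, ∀ᶠ δ : ℝ in 𝓝[>] 0,
      ∑ v ∈ (Λ δ).filter (fun v => v.2 = 0), ∑ t ∈ (Λ δ).filter (fun t => hexGraph.Adj v t),
        K.indicator (fun _ =>
          ‖(δ : ℂ) ^ 2 * hexParafermionicObservable (Λ δ) (a δ) hexCriticalFugacity (5 / 8) s(v, t) /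
              hexParafermionicObservable (Λ δ) (a δ) hexCriticalFugacity (5 / 8) (b δ)‖)
          ((δ : ℂ) * hexMidpoint s(v, t)) ≤ C := by
  sorry

/-! ### Stub 2 — boundary-inclusive twist null in Green form (SAW input, open) -/

/-- **Twist null (Green form, boundary-inclusive).** In the setting of the crux, for every
`χ ∈ C³_c(ℂ ∖ {a})` the class-twisted pairing of `∂χ` with the normalised observable over the interior
mid-edges tends to `0`: `δ² Σ_{e={v,t} ⊂ Λ_δ} u_e ∂χ(δe) F_δ(e)/F_δ(b_δ) → 0`, `u_e = 12 (mid e - c_v)²`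
the unit squared edge direction. (Plain `ψ`-averages see only the class average; this is the weak
curl-freeness of card weak-curl-exact-interior, up to the boundary away from `a`.) -/
theorem stub_twistNull (D : DobrushinDomain) (ρ : ℝ) (Λ : ℝ → Finset HexVertex)
    (m : Fin 2 → ℝ → ℤ) (a b : ℝ → Sym2 HexVertex)
    (Φ : ConformalEquiv D.carrier UpperHalfPlane.upperHalfPlaneSet) (L : ℂ → ℂ) (Lb : ℂ)
    (hρ : 0 < ρ)
    (hflat : ∀ i : Fin 2, D.carrier ∩ ball (D.pt i) ρ = {z : ℂ | (D.pt i).im < z.im} ∩ ball (D.pt i) ρ)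
    (hdisc : ∀ᶠ δ : ℝ in 𝓝[>] 0, hexDomainSimplyConnected (Λ δ) ∧ a δ ∈ hexDomainBoundary (Λ δ) ∧
      b δ ∈ hexDomainBoundary (Λ δ) ∧ Nonempty (HexMidEdgeSAW (Λ δ) (a δ) (b δ)) ∧
      (hexGraph.induce ((Λ δ : Finset HexVertex) : Set HexVertex)).Preconnected ∧
      (∀ v ∈ Λ δ, (δ : ℂ) * hexCenter v ∈ D.carrier) ∧
      (∀ i : Fin 2, ∀ v : HexVertex, (δ : ℂ) * hexCenter v ∈ ball (D.pt i) ρ → (v ∈ Λ δ ↔ m i δ ≤ v.1 1)))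
    (hexh : ∀ K : Set ℂ, IsCompact K → K ⊆ D.carrier → ∀ᶠ δ : ℝ in 𝓝[>] 0,
      ∀ v : HexVertex, (δ : ℂ) * hexCenter v ∈ K → v ∈ Λ δ)
    (ha : Tendsto (fun δ : ℝ => (δ : ℂ) * hexMidpoint (a δ)) (𝓝[>] 0) (𝓝 (D.pt 0)))
    (hb : Tendsto (fun δ : ℝ => (δ : ℂ) * hexMidpoint (b δ)) (𝓝[>] 0) (𝓝 (D.pt 1)))
    (hΦa : Tendsto (fun x => ‖Φ x‖) (𝓝[D.carrier] (D.pt 0)) atTop)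
    (hΦb : Φ.HasBoundaryValue (D.pt 1) 0)
    (hL : ContinuousOn L D.carrier) (hexpL : ∀ z ∈ D.carrier, Complex.exp (L z) = deriv Φ z)
    (hLb : Tendsto L (𝓝[D.carrier] (D.pt 1)) (𝓝 Lb)) :
    ∀ χ : ℂ → ℂ, ContDiff ℝ 3 χ → HasCompactSupport χ → D.pt 0 ∉ tsupport χ →
      Tendsto (fun δ : ℝ =>
        ∑ v ∈ (Λ δ).filter (fun v => v.2 = 0), ∑ t ∈ (Λ δ).filter (fun t => hexGraph.Adj v t),
          (12 * (hexMidpoint s(v, t) - hexCenter v) ^ 2) *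
            ((fderiv ℝ χ ((δ : ℂ) * hexMidpoint s(v, t)) 1 -
                Complex.I * fderiv ℝ χ ((δ : ℂ) * hexMidpoint s(v, t)) Complex.I) / 2) *
            ((δ : ℂ) ^ 2 * hexParafermionicObservable (Λ δ) (a δ) hexCriticalFugacity (5 / 8) s(v, t) /
              hexParafermionicObservable (Λ δ) (a δ) hexCriticalFugacity (5 / 8) (b δ)))
        (𝓝[>] 0) (𝓝 0) := by
  sorry

/-! ### Stub 3 — the boundary flux limit in Green form (SAW input, open) -/

/-- **Boundary flux limit (Green form).** One universal `c' ≠ 0` such that, in the setting of the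
crux, for every `χ ∈ C³_c(ℂ ∖ {a})` the normalised boundary flux
`δ Σ_{v ∈ Λ_δ, u ∼ v, u ∉ Λ_δ} χ(δ c_v) (mid{v,u} - c_v) F_δ({v,u}) / F_δ(b_δ)` (boundary mid-edges only:
`|F_δ|` = arc partition function, `arg F_δ` = rigid boundary winding phase) converges to
`c' ∫_Ω ∂̄χ · e^{(5/8)(L - L_b)} dA`. -/
theorem stub_boundaryFlux : ∃ c' : ℂ, c' ≠ 0 ∧
    ∀ (D : DobrushinDomain) (ρ : ℝ) (Λ : ℝ → Finset HexVertex)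
    (m : Fin 2 → ℝ → ℤ) (a b : ℝ → Sym2 HexVertex)
    (Φ : ConformalEquiv D.carrier UpperHalfPlane.upperHalfPlaneSet) (L : ℂ → ℂ) (Lb : ℂ),
    0 < ρ →
    (∀ i : Fin 2, D.carrier ∩ ball (D.pt i) ρ = {z : ℂ | (D.pt i).im < z.im} ∩ ball (D.pt i) ρ) →
    (∀ᶠ δ : ℝ in 𝓝[>] 0, hexDomainSimplyConnected (Λ δ) ∧ a δ ∈ hexDomainBoundary (Λ δ) ∧
      b δ ∈ hexDomainBoundary (Λ δ) ∧ Nonempty (HexMidEdgeSAW (Λ δ) (a δ) (b δ)) ∧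
      (hexGraph.induce ((Λ δ : Finset HexVertex) : Set HexVertex)).Preconnected ∧
      (∀ v ∈ Λ δ, (δ : ℂ) * hexCenter v ∈ D.carrier) ∧
      (∀ i : Fin 2, ∀ v : HexVertex, (δ : ℂ) * hexCenter v ∈ ball (D.pt i) ρ →
        (v ∈ Λ δ ↔ m i δ ≤ v.1 1))) →
    (∀ K : Set ℂ, IsCompact K → K ⊆ D.carrier → ∀ᶠ δ : ℝ in 𝓝[>] 0,
      ∀ v : HexVertex, (δ : ℂ) * hexCenter v ∈ K → v ∈ Λ δ) →
    Tendsto (fun δ : ℝ => (δ : ℂ) * hexMidpoint (a δ)) (𝓝[>] 0) (𝓝 (D.pt 0)) →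
    Tendsto (fun δ : ℝ => (δ : ℂ) * hexMidpoint (b δ)) (𝓝[>] 0) (𝓝 (D.pt 1)) →
    Tendsto (fun x => ‖Φ x‖) (𝓝[D.carrier] (D.pt 0)) atTop →
    Φ.HasBoundaryValue (D.pt 1) 0 →
    ContinuousOn L D.carrier → (∀ z ∈ D.carrier, Complex.exp (L z) = deriv Φ z) →
    Tendsto L (𝓝[D.carrier] (D.pt 1)) (𝓝 Lb) →
    ∀ χ : ℂ → ℂ, ContDiff ℝ 3 χ → HasCompactSupport χ → D.pt 0 ∉ tsupport χ →
      Tendsto (fun δ : ℝ => (δ : ℂ) *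
        ∑ v ∈ Λ δ, ∑ u ∈ (nbrs v).filter (· ∉ Λ δ),
          χ ((δ : ℂ) * hexCenter v) * ((hexMidpoint s(v, u) - hexCenter v) *
            hexParafermionicObservable (Λ δ) (a δ) hexCriticalFugacity (5 / 8) s(v, u)) /
            hexParafermionicObservable (Λ δ) (a δ) hexCriticalFugacity (5 / 8) (b δ))
        (𝓝[>] 0)
        (𝓝 (c' * ∫ z in D.carrier,
          (fderiv ℝ χ z 1 + Complex.I * fderiv ℝ χ z Complex.I) / 2 *
            Complex.exp ((5 / 8 : ℂ) * (L z - Lb)))) := by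
  sorry


/-! ## §2 Name-keyed aliases of the three stub statements — the hypotheses of `BulkToBoundary_of`

(`#h21_check_skeleton` admits a hypothesis of the skeleton theorem only if its head constant is NAMED
like a declared stub; each alias below is `rfl`-equal to the type of its stub, cf. `birth.lean`.) -/
namespace __Registered

/-- Alias of the statement of `stub_massBound`, keyed by the registered stub name. -/
abbrev stub_massBound : Prop :=
  ∀ (D : DobrushinDomain) (ρ : ℝ) (Λ : ℝ → Finset HexVertex)
    (m : Fin 2 → ℝ → ℤ) (a b : ℝ → Sym2 HexVertex)
    (Φ : ConformalEquiv D.carrier UpperHalfPlane.upperHalfPlaneSet) (L : ℂ → ℂ) (Lb : ℂ)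
    (hρ : 0 < ρ)
    (hflat : ∀ i : Fin 2, D.carrier ∩ ball (D.pt i) ρ = {z : ℂ | (D.pt i).im < z.im} ∩ ball (D.pt i) ρ)
    (hdisc : ∀ᶠ δ : ℝ in 𝓝[>] 0, hexDomainSimplyConnected (Λ δ) ∧ a δ ∈ hexDomainBoundary (Λ δ) ∧
      b δ ∈ hexDomainBoundary (Λ δ) ∧ Nonempty (HexMidEdgeSAW (Λ δ) (a δ) (b δ)) ∧
      (hexGraph.induce ((Λ δ : Finset HexVertex) : Set HexVertex)).Preconnected ∧
      (∀ v ∈ Λ δ, (δ : ℂ) * hexCenter v ∈ D.carrier) ∧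
      (∀ i : Fin 2, ∀ v : HexVertex, (δ : ℂ) * hexCenter v ∈ ball (D.pt i) ρ → (v ∈ Λ δ ↔ m i δ ≤ v.1 1)))
    (hexh : ∀ K : Set ℂ, IsCompact K → K ⊆ D.carrier → ∀ᶠ δ : ℝ in 𝓝[>] 0,
      ∀ v : HexVertex, (δ : ℂ) * hexCenter v ∈ K → v ∈ Λ δ)
    (ha : Tendsto (fun δ : ℝ => (δ : ℂ) * hexMidpoint (a δ)) (𝓝[>] 0) (𝓝 (D.pt 0)))
    (hb : Tendsto (fun δ : ℝ => (δ : ℂ) * hexMidpoint (b δ)) (𝓝[>] 0) (𝓝 (D.pt 1)))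
    (hΦa : Tendsto (fun x => ‖Φ x‖) (𝓝[D.carrier] (D.pt 0)) atTop)
    (hΦb : Φ.HasBoundaryValue (D.pt 1) 0)
    (hL : ContinuousOn L D.carrier) (hexpL : ∀ z ∈ D.carrier, Complex.exp (L z) = deriv Φ z)
    (hLb : Tendsto L (𝓝[D.carrier] (D.pt 1)) (𝓝 Lb)),
    ∀ K : Set ℂ, IsCompact K → D.pt 0 ∉ K → ∃ C : ℝ, ∀ᶠ δ : ℝ in 𝓝[>] 0,
      ∑ v ∈ (Λ δ).filter (fun v => v.2 = 0), ∑ t ∈ (Λ δ).filter (fun t => hexGraph.Adj v t),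
        K.indicator (fun _ =>
          ‖(δ : ℂ) ^ 2 * hexParafermionicObservable (Λ δ) (a δ) hexCriticalFugacity (5 / 8) s(v, t) /
              hexParafermionicObservable (Λ δ) (a δ) hexCriticalFugacity (5 / 8) (b δ)‖)
          ((δ : ℂ) * hexMidpoint s(v, t)) ≤ C

/-- Alias of the statement of `stub_twistNull`, keyed by the registered stub name. -/
abbrev stub_twistNull : Prop :=
  ∀ (D : DobrushinDomain) (ρ : ℝ) (Λ : ℝ → Finset HexVertex)
    (m : Fin 2 → ℝ → ℤ) (a b : ℝ → Sym2 HexVertex)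
    (Φ : ConformalEquiv D.carrier UpperHalfPlane.upperHalfPlaneSet) (L : ℂ → ℂ) (Lb : ℂ)
    (hρ : 0 < ρ)
    (hflat : ∀ i : Fin 2, D.carrier ∩ ball (D.pt i) ρ = {z : ℂ | (D.pt i).im < z.im} ∩ ball (D.pt i) ρ)
    (hdisc : ∀ᶠ δ : ℝ in 𝓝[>] 0, hexDomainSimplyConnected (Λ δ) ∧ a δ ∈ hexDomainBoundary (Λ δ) ∧
      b δ ∈ hexDomainBoundary (Λ δ) ∧ Nonempty (HexMidEdgeSAW (Λ δ) (a δ) (b δ)) ∧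
      (hexGraph.induce ((Λ δ : Finset HexVertex) : Set HexVertex)).Preconnected ∧
      (∀ v ∈ Λ δ, (δ : ℂ) * hexCenter v ∈ D.carrier) ∧
      (∀ i : Fin 2, ∀ v : HexVertex, (δ : ℂ) * hexCenter v ∈ ball (D.pt i) ρ → (v ∈ Λ δ ↔ m i δ ≤ v.1 1)))
    (hexh : ∀ K : Set ℂ, IsCompact K → K ⊆ D.carrier → ∀ᶠ δ : ℝ in 𝓝[>] 0,
      ∀ v : HexVertex, (δ : ℂ) * hexCenter v ∈ K → v ∈ Λ δ)
    (ha : Tendsto (fun δ : ℝ => (δ : ℂ) * hexMidpoint (a δ)) (𝓝[>] 0) (𝓝 (D.pt 0)))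
    (hb : Tendsto (fun δ : ℝ => (δ : ℂ) * hexMidpoint (b δ)) (𝓝[>] 0) (𝓝 (D.pt 1)))
    (hΦa : Tendsto (fun x => ‖Φ x‖) (𝓝[D.carrier] (D.pt 0)) atTop)
    (hΦb : Φ.HasBoundaryValue (D.pt 1) 0)
    (hL : ContinuousOn L D.carrier) (hexpL : ∀ z ∈ D.carrier, Complex.exp (L z) = deriv Φ z)
    (hLb : Tendsto L (𝓝[D.carrier] (D.pt 1)) (𝓝 Lb)),
    ∀ χ : ℂ → ℂ, ContDiff ℝ 3 χ → HasCompactSupport χ → D.pt 0 ∉ tsupport χ →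
      Tendsto (fun δ : ℝ =>
        ∑ v ∈ (Λ δ).filter (fun v => v.2 = 0), ∑ t ∈ (Λ δ).filter (fun t => hexGraph.Adj v t),
          (12 * (hexMidpoint s(v, t) - hexCenter v) ^ 2) *
            ((fderiv ℝ χ ((δ : ℂ) * hexMidpoint s(v, t)) 1 -
                Complex.I * fderiv ℝ χ ((δ : ℂ) * hexMidpoint s(v, t)) Complex.I) / 2) *
            ((δ : ℂ) ^ 2 * hexParafermionicObservable (Λ δ) (a δ) hexCriticalFugacity (5 / 8) s(v, t) /
              hexParafermionicObservable (Λ δ) (a δ) hexCriticalFugacity (5 / 8) (b δ)))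
        (𝓝[>] 0) (𝓝 0)

/-- Alias of the statement of `stub_boundaryFlux`, keyed by the registered stub name. -/
abbrev stub_boundaryFlux : Prop :=
  ∃ c' : ℂ, c' ≠ 0 ∧
    ∀ (D : DobrushinDomain) (ρ : ℝ) (Λ : ℝ → Finset HexVertex)
    (m : Fin 2 → ℝ → ℤ) (a b : ℝ → Sym2 HexVertex)
    (Φ : ConformalEquiv D.carrier UpperHalfPlane.upperHalfPlaneSet) (L : ℂ → ℂ) (Lb : ℂ),
    0 < ρ →
    (∀ i : Fin 2, D.carrier ∩ ball (D.pt i) ρ = {z : ℂ | (D.pt i).im < z.im} ∩ ball (D.pt i) ρ) →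
    (∀ᶠ δ : ℝ in 𝓝[>] 0, hexDomainSimplyConnected (Λ δ) ∧ a δ ∈ hexDomainBoundary (Λ δ) ∧
      b δ ∈ hexDomainBoundary (Λ δ) ∧ Nonempty (HexMidEdgeSAW (Λ δ) (a δ) (b δ)) ∧
      (hexGraph.induce ((Λ δ : Finset HexVertex) : Set HexVertex)).Preconnected ∧
      (∀ v ∈ Λ δ, (δ : ℂ) * hexCenter v ∈ D.carrier) ∧
      (∀ i : Fin 2, ∀ v : HexVertex, (δ : ℂ) * hexCenter v ∈ ball (D.pt i) ρ →
        (v ∈ Λ δ ↔ m i δ ≤ v.1 1))) →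
    (∀ K : Set ℂ, IsCompact K → K ⊆ D.carrier → ∀ᶠ δ : ℝ in 𝓝[>] 0,
      ∀ v : HexVertex, (δ : ℂ) * hexCenter v ∈ K → v ∈ Λ δ) →
    Tendsto (fun δ : ℝ => (δ : ℂ) * hexMidpoint (a δ)) (𝓝[>] 0) (𝓝 (D.pt 0)) →
    Tendsto (fun δ : ℝ => (δ : ℂ) * hexMidpoint (b δ)) (𝓝[>] 0) (𝓝 (D.pt 1)) →
    Tendsto (fun x => ‖Φ x‖) (𝓝[D.carrier] (D.pt 0)) atTop →
    Φ.HasBoundaryValue (D.pt 1) 0 →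
    ContinuousOn L D.carrier → (∀ z ∈ D.carrier, Complex.exp (L z) = deriv Φ z) →
    Tendsto L (𝓝[D.carrier] (D.pt 1)) (𝓝 Lb) →
    ∀ χ : ℂ → ℂ, ContDiff ℝ 3 χ → HasCompactSupport χ → D.pt 0 ∉ tsupport χ →
      Tendsto (fun δ : ℝ => (δ : ℂ) *
        ∑ v ∈ Λ δ, ∑ u ∈ (nbrs v).filter (· ∉ Λ δ),
          χ ((δ : ℂ) * hexCenter v) * ((hexMidpoint s(v, u) - hexCenter v) *
            hexParafermionicObservable (Λ δ) (a δ) hexCriticalFugacity (5 / 8) s(v, u)) /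
            hexParafermionicObservable (Λ δ) (a δ) hexCriticalFugacity (5 / 8) (b δ))
        (𝓝[>] 0)
        (𝓝 (c' * ∫ z in D.carrier,
          (fderiv ℝ χ z 1 + Complex.I * fderiv ℝ χ z Complex.I) / 2 *
            Complex.exp ((5 / 8 : ℂ) * (L z - Lb))))

end __Registered

/-! ### Consistency: each registered stub proves its name-keyed alias (so the aliases ARE the stub types) -/

theorem massBound_of_stub : __Registered.stub_massBound := stub_massBound
theorem twistNull_of_stub : __Registered.stub_twistNull := stub_twistNull
theorem boundaryFlux_of_stub : __Registered.stub_boundaryFlux := stub_boundaryFlux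

/-! ## §3 The two route copies of the target are one proposition -/

/-- `SAWQuarterTwist.HexObservableLimitR` and `SAWDefectDecoherence.HexObservableLimitR` are the
byte-identical proposition (one shared item stmt-CriticalPhenomena-14003). -/
theorem hexObservableLimitR_iff_defectDecoherence :
    Summit.CriticalPhenomena.SAWScalingLimit.Theses.SAWQuarterTwist.HexObservableLimitR ↔
      Summit.CriticalPhenomena.SAWScalingLimit.Theses.SAWDefectDecoherence.HexObservableLimitR :=
  Iff.rfl

/-! ## §4 The sorry-free part: the three SAW inputs ⇒ the target, BY NAME (hypothesis form)

This is the composition `HexObservableLimitR_of` of `explicit_bump_synthesis.lean` with the three SAW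
stubs turned into hypotheses (so that `#print axioms` of everything below is standard): boundary flux
gives the universal `c'`; on an admissible flat-pinned family, mass bound + twist null + boundary flux
feed the landed Green identity `stub_greenLimit` (the `∂̄`-moments of the normalised pair measures
converge to `6c' ∫_Ω ∂̄χ e^{(5/8)(L-L_b)}`), the landed `stub_densityIntegrable` gives integrability
of the density off the root, the PROVED `bumpSynthesis_of_stubs` upgrades `∂̄`-moment convergence +
mass bound to convergence against every `ψ ∈ C_c(Ω)`, and the landed `stub_reindex` identifies the
pair sum with the crux's `finsum` over mid-edges. -/
theorem hexObservableLimitR_of (hMB0 : __Registered.stub_massBound)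
    (hTN0 : __Registered.stub_twistNull) (hBF0 : __Registered.stub_boundaryFlux) :
    Summit.CriticalPhenomena.SAWScalingLimit.Theses.SAWQuarterTwist.HexObservableLimitR := by
  rw [hexObservableLimitR_iff_defectDecoherence]
  obtain ⟨c', hc', hBF⟩ := hBF0
  refine ⟨6 * c', mul_ne_zero (by norm_num) hc', ?_⟩
  intro D ρ Λ m a b Φ L Lb ψ F hρ hflat hdisc hexh ha hb hΦa hΦb hL hexpL hLb hψc hψs hψΩ
  -- the inputs of the line, instantiated on this admissible family
  have hMB := hMB0 D ρ Λ m a b Φ L Lb hρ hflat hdisc hexh ha hb hΦa hΦb hL hexpL hLb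
  have hTN := hTN0 D ρ Λ m a b Φ L Lb hρ hflat hdisc hexh ha hb hΦa hΦb hL hexpL hLb
  have hBF' := hBF D ρ Λ m a b Φ L Lb hρ hflat hdisc hexh ha hb hΦa hΦb hL hexpL hLb
  have hGL := stub_greenLimit D Λ a b L Lb (hdisc.mono fun δ h => ⟨h.1, h.2.1⟩) hMB hTN c' hBF'
  have hgi := stub_densityIntegrable D ρ Φ L Lb hρ hflat hΦa hΦb hL hexpL hLb
  have hpt : D.pt 0 ∉ D.carrier := pt_not_mem_carrier D 0
  have hg : ContinuousOn (fun z => Complex.exp ((5 / 8 : ℂ) * (L z - Lb))) D.carrier :=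
    Complex.continuous_exp.comp_continuousOn (continuousOn_const.mul (hL.sub continuousOn_const))
  -- the finitely supported normalised measures on black→white interior pairs
  set E : ℝ → Finset (HexVertex × HexVertex) := fun δ =>
    (((Λ δ).filter fun v => v.2 = 0) ×ˢ Λ δ).filter (fun p => hexGraph.Adj p.1 p.2) with hE
  set pt : ℝ → HexVertex × HexVertex → ℂ := fun δ p => (δ : ℂ) * hexMidpoint s(p.1, p.2) with hpt'
  set w : ℝ → HexVertex × HexVertex → ℂ := fun δ p =>
    (δ : ℂ) ^ 2 * F δ s(p.1, p.2) / F δ (b δ) with hw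
  have hδpos : ∀ᶠ δ : ℝ in 𝓝[>] 0, 0 < δ := eventually_mem_nhdsWithin
  -- support within `δ` of `Ω`
  have hnear : ∀ᶠ δ : ℝ in 𝓝[>] 0, ∀ p ∈ E δ, infDist (pt δ p) D.carrier ≤ δ := by
    filter_upwards [hdisc, hδpos] with δ hd hδ
    intro p hp
    rw [hE, mem_pairFinset] at hp
    obtain ⟨h1, -, -, hadj⟩ := hp
    have hin : (δ : ℂ) * hexCenter p.1 ∈ D.carrier := hd.2.2.2.2.2.1 p.1 h1
    calc infDist (pt δ p) D.carrier ≤ dist (pt δ p) ((δ : ℂ) * hexCenter p.1) :=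
          infDist_le_dist_of_mem hin
      _ ≤ δ / 2 := dist_mid_center_le hδ.le hadj
      _ ≤ δ := by linarith
  -- the mass bound in the synthesis' format
  have hmass : ∀ K : Set ℂ, IsCompact K → D.pt 0 ∉ K → ∃ C : ℝ, ∀ᶠ δ : ℝ in 𝓝[>] 0,
      ∑ p ∈ E δ, K.indicator (fun _ => ‖w δ p‖) (pt δ p) ≤ C := by
    intro K hK hKa
    obtain ⟨C, hC⟩ := hMB K hK hKa
    refine ⟨C, hC.mono fun δ hδ => ?_⟩
    rw [hE, sum_pairFinset_eq]
    convert hδ using 1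
  -- the `∂̄`-moments
  have hdbar : ∀ χ : ℂ → ℂ, ContDiff ℝ 3 χ → HasCompactSupport χ → D.pt 0 ∉ tsupport χ →
      Tendsto (fun δ : ℝ => ∑ p ∈ E δ,
        (fderiv ℝ χ (pt δ p) 1 + Complex.I * fderiv ℝ χ (pt δ p) Complex.I) / 2 * w δ p)
        (𝓝[>] 0)
        (𝓝 ((6 * c') * ∫ z in D.carrier,
          (fderiv ℝ χ z 1 + Complex.I * fderiv ℝ χ z Complex.I) / 2 *
            Complex.exp ((5 / 8 : ℂ) * (L z - Lb)))) := by
    intro χ hχ hχs hχa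
    exact hGL χ hχ hχs hχa
  have key := bumpSynthesis_of_stubs D.carrier D.isOpen D.isBounded (D.pt 0) hpt
    (fun z => Complex.exp ((5 / 8 : ℂ) * (L z - Lb))) hg hgi (6 * c') E pt w hnear hmass hdbar
    ψ hψc hψs hψΩ
  have hre := stub_reindex D Λ a b ψ hexh hψc hψs hψΩ
  refine key.congr' ?_
  filter_upwards [hre] with δ hδ
  exact hδ.symm

/-- The antecedents (P), (B) of the crux are idle: the target alone gives the crux (weakening).
Recorded so that the skeleton registry shows the shape of the reduction honestly. -/
theorem BulkToBoundary_of_target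
    (h : Summit.CriticalPhenomena.SAWScalingLimit.Theses.SAWQuarterTwist.HexObservableLimitR) :
    Summit.CriticalPhenomena.SAWScalingLimit.Theses.SAWQuarterTwist.BulkToBoundary :=
  fun _ _ => h

/-! ## §5 The skeleton theorem: the three stubs imply the crux, BY NAME -/

/-- **`BulkToBoundary` from the line `shared_green`** (kernel-checked, no `sorry` of its own):
hypotheses = the three SAW stubs of the target's Green-form cut under their registered names (shared
with crux stmt-CriticalPhenomena-14003); conclusion = the route decl, by name. -/
theorem BulkToBoundary_of (h1 : __Registered.stub_massBound) (h2 : __Registered.stub_twistNull)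
    (h3 : __Registered.stub_boundaryFlux) :
    Summit.CriticalPhenomena.SAWScalingLimit.Theses.SAWQuarterTwist.BulkToBoundary :=
  BulkToBoundary_of_target (hexObservableLimitR_of h1 h2 h3)

/-- Wiring check (an `example`, so that `BulkToBoundary_of` stays the only theorem concluding the
crux): the registered stubs, with their stated types, feed the skeleton theorem. -/
example : Summit.CriticalPhenomena.SAWScalingLimit.Theses.SAWQuarterTwist.BulkToBoundary :=
  BulkToBoundary_of stub_massBound stub_twistNull stub_boundaryFlux

end Summit.CriticalPhenomena.SAWScalingLimit.Cruxes.BulkToBoundary.SharedGreen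

end
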